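import Summits.QuantumFields.YangMills.Theses.ThermalDescent

/-!
# Assembly of route `ThermalDescent` (rung R2a of LADDER-YM, leaf `BalabanLadder.NT`; item stmt-QuantumFields-26516)

The route file's kernel-checked deciding theorem `closes` packaged as the proof of the route's `Assembly` item (the implication from the route's
items to its leaf, in the route's order).  No summit and no Clay statement is proved here; the leaf stays open behind the route's open items.
Filed by the width seat `ym-line-sfw-p2-w2` gen 16 as one-line bookkeeping only (no staffing implied; nothing else on this route is touched).
-/

namespace Summit.QuantumFields.YangMills.Theorems

open Summit.QuantumFields.YangMills.Theses.ThermalDescent in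
/-- The `Assembly` item of route `ThermalDescent` holds: it is the route's deciding theorem `closes` read as an implication. Nothing about the mass gap. -/
theorem thermalDescent_assembly : Summit.QuantumFields.YangMills.Theses.ThermalDescent.Assembly :=
  fun hZ hP hE hD hH hS => closes hZ hP hE hD hH hS

end Summit.QuantumFields.YangMills.Theorems
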